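import Summits.Ventures.PercRepro.Night2LocalD3TwoOneB

/-!
# PercRepro — the cell `(a, k) = (2, 1)` at `|E ∖ G| = 3`, `q = 4`: **`load2_le_cap2_two_one`** (night-2, gen 13)

At a far set `S` with `coloops S = K ∪ {x}` (`K = {y}` the coloop of `M|G`), `cap₂(S) ≥ 7/10 − [S ∖ x member]·req(S ∖ x) ≥ 0.46`;
the members carrying weight are the pair members `S ∖ {z, z'}` (`z, z'` non-coloops) and the layer-1 request at a covering set
`S ∖ v` is at most `6/25` (the deletion through `x`) plus the requests of the three pair deletions `(S ∖ v) ∖ t`.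

* at most one fat pair member: the three pair deletions carry at most one fat request, `L₁ ≤ 22/25`, loss fraction `≤ 9/44`,
  `w₂ ≤ 27/275` (fat) resp. `9/220`, and `#ex2 ≤ 6`: `load₂ ≤ 6 · 9/220 + (27/275 − 9/220) ≤ 0.46`;
* two fat pair members: they kill the preimage `S ∖ x` (`cap₂ ≥ 7/10`), at most two of the three pair deletions are fat
  (`L₁ ≤ 23/25`, loss fraction `≤ 11/46`), every `w₂ ≤ 2 · (6/25)(11/46)`, `load₂ ≤ 6 · 66/575 ≤ 7/10`.
-/

open scoped Matroid

namespace PercRepro.Shadow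

open Finset PerFlat ThmH

variable {α : Type*} [DecidableEq α] {M : Matroid α} [M.Finite]

section TwoOneC

variable {G S : Finset α}

open scoped Classical in
/-- The layer-1 request at `S ∖ v` (`v` a non-coloop) through the pair deletions, with a bound on the number of fat members among
them: `L₁(S ∖ v) ≤ 6/25 + 3/5 + n/25` when at most `n` of the three deletions `(S ∖ v) ∖ t` are fat members. -/
theorem L1_erase_le_two_one (hG : G ∈ flatsQ M (4 + 1)) (hd : (gr M \ G).card = 3)
    (hS : S ∈ shadowAt M (4 + 2) 4 (Uq M (4 + 2) 4) G) (hS6 : S.card = 6) (ha : (coloops M S).card = 2) {x : α}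
    (hxK : x ∉ G.filter (fun y => y ∉ clF M (G.erase y)))
    (hcol : coloops M S = insert x (G.filter (fun y => y ∉ clF M (G.erase y)))) {v : α} (hv : v ∈ nonColoops M S)
    (hSv : S.erase v ∈ shadowAt M (4 + 2) 4 (Uq M (4 + 2) 4) G) {n : ℕ}
    (hn : (((nonColoops M S).erase v).filter (fun t => (S.erase v).erase t ∈ membersIn M (Uq M (4 + 2) 4) G ∧
      G \ S ⊆ clF M ((S.erase v).erase t))).card ≤ n) :
    L1 M 4 G (S.erase v) ≤ 6 / 25 + 3 / 5 + (n : ℚ) / 25 := by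
  set K := G.filter (fun y => y ∉ clF M (G.erase y)) with hKdef
  have hGg : G ⊆ gr M := (mem_flatsQ.1 hG).1
  have hSG : S ⊆ G := subset_of_mem_shadowAt hS
  have hxc : x ∈ coloops M S := by rw [hcol]; exact Finset.mem_insert_self _ _
  have hxS : x ∈ S := coloops_subset_self S hxc
  have hxv : x ≠ v := fun h => (mem_nonColoops.1 hv).2 (h ▸ hxc)
  have hxe : x ∈ gr M \ clF M (S.erase x) := Finset.mem_sdiff.2 ⟨hGg (hSG hxS), (mem_coloops.1 hxc).2⟩
  have hreqx : req M 4 (S.erase x) ≤ 6 / 25 := by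
    have := req_le_of_le_card hG hd (clF_subset_of_subset_flatsQ hG ((Finset.erase_subset x S).trans hSG))
      (two_le_card_sdiff_clF_erase hS hxK hxc)
    norm_num at this; exact this
  have hT3 : ((nonColoops M S).erase v).card = 3 := by
    have hT4 : (nonColoops M S).card = 4 := by
      have := Finset.card_sdiff_add_card_eq_card (coloops_subset_self (M := M) S)
      unfold nonColoops; omega
    rw [Finset.card_erase_of_mem hv, hT4]
  refine (L1_le_sum_erase hG hd hSv).trans ?_
  -- `(S ∖ v) ∖ K = insert x (T' ∖ v)`
  have hset : (S.erase v) \ K = insert x ((nonColoops M S).erase v) := by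
    ext e
    rw [Finset.mem_sdiff, Finset.mem_erase, Finset.mem_insert, Finset.mem_erase]
    constructor
    · rintro ⟨⟨hev, heS⟩, heK⟩
      rcases mem_coloops_or_mem_nonColoops (M := M) heS with hc | hn'
      · rw [hcol, Finset.mem_insert] at hc
        rcases hc with h | h
        · exact Or.inl h
        · exact absurd h heK
      · exact Or.inr ⟨hev, hn'⟩
    · rintro (rfl | ⟨hev, hn'⟩)
      · exact ⟨⟨hxv, hxS⟩, hxK⟩
      · exact ⟨⟨hev, (mem_nonColoops.1 hn').1⟩, fun h => (mem_nonColoops.1 hn').2 (by rw [hcol]; exact Finset.mem_insert_of_mem h)⟩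
  rw [hset, Finset.sum_insert (fun h => (mem_nonColoops.1 (Finset.mem_erase.1 h).2).2 hxc)]
  have h1 : (if (S.erase v).erase x ∈ membersIn M (Uq M (4 + 2) 4) G then req M 4 ((S.erase v).erase x) else 0) ≤
      6 / 25 := by
    split_ifs with h
    · exact (req_le_req_of_subset (Finset.erase_subset_erase x (Finset.erase_subset v S)) hxe).trans hreqx
    · norm_num
  have h2 : ∀ t ∈ (nonColoops M S).erase v,
      (if (S.erase v).erase t ∈ membersIn M (Uq M (4 + 2) 4) G then req M 4 ((S.erase v).erase t) else 0) ≤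
        1 / 5 + (if ((S.erase v).erase t ∈ membersIn M (Uq M (4 + 2) 4) G ∧ G \ S ⊆ clF M ((S.erase v).erase t))
          then (1 / 25 : ℚ) else 0) := by
    intro t ht
    rw [Finset.mem_erase] at ht
    obtain ⟨hc, hsub, hcard⟩ := pair_shape_of_erase_erase' hv ht.2 (Ne.symm ht.1)
    by_cases hm : (S.erase v).erase t ∈ membersIn M (Uq M (4 + 2) 4) G
    · rw [if_pos hm]
      by_cases hf : G \ S ⊆ clF M ((S.erase v).erase t)
      · rw [if_pos ⟨hm, hf⟩]
        have := (req_pair_le' hG hd hS hS6 hm hc hsub hcard).1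
        linarith
      · rw [if_neg (fun h => hf h.2)]
        have := (req_pair_le' hG hd hS hS6 hm hc hsub hcard).2.1 hf
        linarith
    · rw [if_neg hm]
      split_ifs <;> norm_num
  calc (if (S.erase v).erase x ∈ membersIn M (Uq M (4 + 2) 4) G then req M 4 ((S.erase v).erase x) else 0) +
        ∑ t ∈ (nonColoops M S).erase v,
          (if (S.erase v).erase t ∈ membersIn M (Uq M (4 + 2) 4) G then req M 4 ((S.erase v).erase t) else 0)
      ≤ 6 / 25 + ∑ t ∈ (nonColoops M S).erase v, (1 / 5 + (if ((S.erase v).erase t ∈ membersIn M (Uq M (4 + 2) 4) G ∧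
          G \ S ⊆ clF M ((S.erase v).erase t)) then (1 / 25 : ℚ) else 0)) := by
        have := Finset.sum_le_sum h2
        linarith
    _ = 6 / 25 + (3 / 5 + (1 / 25) * ((((nonColoops M S).erase v).filter (fun t =>
          (S.erase v).erase t ∈ membersIn M (Uq M (4 + 2) 4) G ∧ G \ S ⊆ clF M ((S.erase v).erase t))).card : ℚ)) := by
        rw [Finset.sum_add_distrib, Finset.sum_const, hT3, Finset.sum_ite, Finset.sum_const_zero, add_zero,
          Finset.sum_const, nsmul_eq_mul, nsmul_eq_mul]
        push_cast
        ring
    _ ≤ 6 / 25 + 3 / 5 + (n : ℚ) / 25 := by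
        have : ((((nonColoops M S).erase v).filter (fun t => (S.erase v).erase t ∈ membersIn M (Uq M (4 + 2) 4) G ∧
            G \ S ⊆ clF M ((S.erase v).erase t))).card : ℚ) ≤ n := by exact_mod_cast hn
        linarith

open scoped Classical in
/-- **THE CELL `(a, k) = (2, 1)` AT `|E ∖ G| = 3`, `q = 4`**: every far set with two coloops satisfies `load₂(S) ≤ cap₂(S)`
when `M|G` has one coloop. -/
theorem load2_le_cap2_two_one (hs : ∀ e ∈ gr M, ∀ f ∈ gr M, e ≠ f → rkN M {e, f} = 2) (hl : ∀ e ∈ gr M, M.Indep {e})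
    (hG : G ∈ flatsQ M (4 + 1)) (hd : (gr M \ G).card = 3) (hk : kColoops M G = 1)
    (hS : S ∈ shadowAt M (4 + 2) 4 (Uq M (4 + 2) 4) G) (ha : (coloops M S).card = 2) :
    load2 M 4 G S ≤ cap2 M 4 G S := by
  set K := G.filter (fun y => y ∉ clF M (G.erase y)) with hKdef
  obtain ⟨x, hxK, hcol⟩ := exists_coloops_eq_insert_one hS hk ha
  have hSG : S ⊆ G := subset_of_mem_shadowAt hS
  have hGg : G ⊆ gr M := (mem_flatsQ.1 hG).1
  have hcap0 : ∀ S', 0 ≤ capS M 4 G S' := capS_nonneg' hG (by omega)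
  have hxc : x ∈ coloops M S := by rw [hcol]; exact Finset.mem_insert_self _ _
  have hxS : x ∈ S := coloops_subset_self S hxc
  set ρ := (if S.erase x ∈ membersIn M (Uq M (4 + 2) 4) G then req M 4 (S.erase x) else 0) with hρdef
  have hreqx : req M 4 (S.erase x) ≤ 6 / 25 := by
    have := req_le_of_le_card hG hd (clF_subset_of_subset_flatsQ hG ((Finset.erase_subset x S).trans hSG))
      (two_le_card_sdiff_clF_erase hS hxK hxc)
    norm_num at this; exact this
  have hρle : ρ ≤ 6 / 25 := by rw [hρdef]; split_ifs; exact hreqx; norm_num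
  have hρ0 : 0 ≤ ρ := by rw [hρdef]; split_ifs; exact req_nonneg 4 _; exact le_refl _
  have hcap2 : 7 / 10 - ρ ≤ cap2 M 4 G S := by
    have h1 := cap2_ge_capS_sub_L1 (M := M) (q := 4) (G := G) (S := S) (hcap0 S)
    have h2 := L1_le_req_erase_one hG hd hS hxK hcol
    have h3 := seven_tenths_le_capS hd hk hSG
    linarith
  by_cases hex : ex2 M 4 G S = ∅
  · rw [load2_eq_zero_of_ex2_eq_empty hex]
    exact cap2_nonneg (hcap0 S)
  obtain ⟨B₀, hB₀⟩ := Finset.nonempty_iff_ne_empty.2 hex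
  have hS6 : S.card = 6 := card_eq_six_of_mem_ex2_one hs hl hG hd hk hB₀
  have hex6 : (ex2 M 4 G S).card ≤ 6 := by
    have := two_mul_card_ex2_le hG hS
    rw [ha] at this
    omega
  have hpair : ∀ B ∈ ex2 M 4 G S, B ∈ membersIn M (Uq M (4 + 2) 4) G ∧ coloops M S ⊆ B ∧ B ⊆ S ∧ (S \ B).card = 2 ∧
      S \ B ⊆ G \ clF M B ∧ B ∉ lay0 M 4 G := by
    intro B hB
    obtain ⟨hBm, hB0, hBS, hsub, hcard⟩ := mem_ex2_unpack hB
    exact ⟨hBm, fun e he => mem_of_mem_ex2_of_mem_coloops hG hS hB he, hBS, hcard, hsub, hB0⟩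
  have hP : ∃ p ∈ G, p ∉ S :=
    exists_mem_sdiff_of_card_sdiff_eq_two hG hd (hpair B₀ hB₀).1 (hpair B₀ hB₀).2.2.1 hSG (hpair B₀ hB₀).2.2.2.1
  -- the covering sets and the non-coloop points of a pair
  have hcov : ∀ B ∈ ex2 M 4 G S, ∀ z z', S \ B = {z, z'} → z ≠ z' →
      S.erase z' ∈ shadowAt M (4 + 2) 4 (Uq M (4 + 2) 4) G ∧ z' ∈ nonColoops M S := by
    intro B hB z z' hP hzz'
    refine ⟨erase_mem_shadowAt_of_pair hG hB hP hzz', ?_⟩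
    have hz' : z' ∈ S \ B := by rw [hP]; exact Finset.mem_insert_of_mem (Finset.mem_singleton_self _)
    exact mem_nonColoops.2 ⟨(Finset.mem_sdiff.1 hz').1, fun h => (Finset.mem_sdiff.1 hz').2 ((hpair B hB).2.1 h)⟩
  have hw2 : ∀ B ∈ ex2 M 4 G S, ∀ z z', S \ B = {z, z'} → z ≠ z' →
      w2 M 4 G B S = (loss M 4 G B z + loss M 4 G B z') / (((G \ clF M B).card : ℚ) - 1) := by
    intro B hB z z' hP hzz'
    obtain ⟨-, -, hBS, hcard, hsub, hB0⟩ := hpair B hB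
    unfold w2
    rw [if_pos ⟨hB0, hBS, hsub, hcard⟩, hP, Finset.sum_pair hzz']
  -- the loss of `B = S ∖ {z, z'}` at `S ∖ z'` from a bound on `L₁(S ∖ z')`
  have hloss : ∀ B ∈ ex2 M 4 G S, ∀ z z', S \ B = {z, z'} → z ≠ z' → ∀ L : ℚ, L1 M 4 G (S.erase z') ≤ L →
      loss M 4 G B z ≤ req M 4 B * (if L ≤ 7 / 10 then (0 : ℚ) else (L - 7 / 10) / L) := by
    intro B hB z z' hP hzz' L hL
    have hBS := (hpair B hB).2.2.1
    rw [erase_eq_insert_of_sdiff_pair hBS hP hzz'] at hL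
    have hz : z ∈ S \ B := by rw [hP]; exact Finset.mem_insert_self _ _
    exact loss_le_req_mul_lossFracC (by norm_num) hL (seven_tenths_le_capS hd hk
      (Finset.insert_subset (hSG (Finset.mem_sdiff.1 hz).1) (hBS.trans hSG)))
  -- fat pair members
  set Fat : Finset α → Prop := fun B => B ∈ membersIn M (Uq M (4 + 2) 4) G ∧ coloops M S ⊆ B ∧ B ⊆ S ∧
    (S \ B).card = 2 ∧ G \ S ⊆ clF M B with hFatdef
  -- the fat deletions at a covering set `S ∖ v` are fat pair members; never all three
  have hthree : ∀ v ∈ nonColoops M S,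
      (((nonColoops M S).erase v).filter (fun t => (S.erase v).erase t ∈ membersIn M (Uq M (4 + 2) 4) G ∧
        G \ S ⊆ clF M ((S.erase v).erase t))).card ≤ 2 := by
    intro v hv
    by_contra hlt
    push Not at hlt
    have hT3 : ((nonColoops M S).erase v).card = 3 := by
      have hT4 : (nonColoops M S).card = 4 := by
        have := Finset.card_sdiff_add_card_eq_card (coloops_subset_self (M := M) S)
        unfold nonColoops; omega
      rw [Finset.card_erase_of_mem hv, hT4]
    have hcard3 : (((nonColoops M S).erase v).filter (fun t => (S.erase v).erase t ∈ membersIn M (Uq M (4 + 2) 4) G ∧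
        G \ S ⊆ clF M ((S.erase v).erase t))).card = 3 :=
      le_antisymm ((Finset.card_le_card (Finset.filter_subset _ _)).trans hT3.le) hlt
    obtain ⟨t₁, t₂, t₃, h12, h13, h23, hF⟩ := Finset.card_eq_three.1 hcard3
    have hmem : ∀ t ∈ ({t₁, t₂, t₃} : Finset α), t ∈ (nonColoops M S).erase v ∧
        (S.erase v).erase t ∈ membersIn M (Uq M (4 + 2) 4) G ∧ G \ S ⊆ clF M ((S.erase v).erase t) := by
      intro t ht
      rw [← hF, Finset.mem_filter] at ht
      exact ⟨ht.1, ht.2.1, ht.2.2⟩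
    have hm₁ := hmem t₁ (Finset.mem_insert_self _ _)
    have hm₂ := hmem t₂ (Finset.mem_insert_of_mem (Finset.mem_insert_self _ _))
    have hm₃ := hmem t₃ (Finset.mem_insert_of_mem (Finset.mem_insert_of_mem (Finset.mem_singleton_self _)))
    have hps₁ := pair_shape_of_erase_erase' hv (Finset.mem_erase.1 hm₁.1).2 (Ne.symm (Finset.mem_erase.1 hm₁.1).1)
    have hps₂ := pair_shape_of_erase_erase' hv (Finset.mem_erase.1 hm₂.1).2 (Ne.symm (Finset.mem_erase.1 hm₂.1).1)
    have hps₃ := pair_shape_of_erase_erase' hv (Finset.mem_erase.1 hm₃.1).2 (Ne.symm (Finset.mem_erase.1 hm₃.1).1)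
    have hne : ∀ {a b : α}, a ∈ (nonColoops M S).erase v → b ∈ (nonColoops M S).erase v → a ≠ b →
        (S.erase v).erase a ≠ (S.erase v).erase b := by
      intro a b ha hb hab h
      have haS : a ∈ S.erase v := Finset.mem_erase.2 ⟨(Finset.mem_erase.1 ha).1, (mem_nonColoops.1 (Finset.mem_erase.1 ha).2).1⟩
      have hbS : b ∈ S.erase v := Finset.mem_erase.2 ⟨(Finset.mem_erase.1 hb).1, (mem_nonColoops.1 (Finset.mem_erase.1 hb).2).1⟩
      exact hab (Finset.erase_injOn (S.erase v) haS hbS h)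
    exact not_three_fat_in_erase hs hG hS hS6 ha hxK hcol hv hP hps₁.1 hps₂.1 hps₃.1
      (Finset.erase_subset _ _) (Finset.erase_subset _ _) (Finset.erase_subset _ _) hps₁.2.2 hps₂.2.2 hps₃.2.2
      (hne hm₁.1 hm₂.1 h12) (hne hm₁.1 hm₃.1 h13) (hne hm₂.1 hm₃.1 h23) hm₁.2.2 hm₂.2.2 hm₃.2.2
  have hfrac23 : (if (23 / 25 : ℚ) ≤ 7 / 10 then (0 : ℚ) else (23 / 25 - 7 / 10) / (23 / 25)) = 11 / 46 := by norm_num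
  have hfrac22 : (if (22 / 25 : ℚ) ≤ 7 / 10 then (0 : ℚ) else (22 / 25 - 7 / 10) / (22 / 25)) = 9 / 44 := by norm_num
  by_cases htwo : ∃ B₁ B₂, Fat B₁ ∧ Fat B₂ ∧ B₁ ≠ B₂
  · -- two fat pair members: `cap₂ ≥ 7/10`
    obtain ⟨B₁, B₂, hF₁, hF₂, hne⟩ := htwo
    have hnot : S.erase x ∉ Uq M (4 + 2) 4 :=
      not_erase_mem_Uq_of_two_fat_pairs hG hd hk hS hxK hcol hF₁.1 hF₂.1 hF₁.2.1 hF₂.2.1 hF₁.2.2.1 hF₂.2.2.1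
        hF₁.2.2.2.1 hF₂.2.2.2.1 hne hF₁.2.2.2.2 hF₂.2.2.2.2
    have hρ : ρ = 0 := by rw [hρdef, if_neg (fun h => hnot (mem_membersIn.1 h).1)]
    have hw : ∀ B ∈ ex2 M 4 G S, w2 M 4 G B S ≤ 66 / 575 := by
      intro B hB
      obtain ⟨hBm, hcB, hBS, hcard, hsub, hB0⟩ := hpair B hB
      obtain ⟨z, z', hzz', hPz⟩ := Finset.card_eq_two.1 hcard
      have hPz' : S \ B = {z', z} := by rw [hPz, Finset.pair_comm]
      rw [hw2 B hB z z' hPz hzz']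
      obtain ⟨hSv, hv⟩ := hcov B hB z z' hPz hzz'
      obtain ⟨hSv', hv'⟩ := hcov B hB z' z hPz' hzz'.symm
      have hL := L1_erase_le_two_one hG hd hS hS6 ha hxK hcol hv hSv (hthree z' hv)
      have hL' := L1_erase_le_two_one hG hd hS hS6 ha hxK hcol hv' hSv' (hthree z hv')
      have hl1 := hloss B hB z z' hPz hzz' (23 / 25) (by push_cast at hL; linarith)
      have hl2 := hloss B hB z' z hPz' hzz'.symm (23 / 25) (by push_cast at hL'; linarith)
      rw [hfrac23] at hl1 hl2
      have hreq := (req_pair_le' hG hd hS hS6 hBm hcB hBS hcard).1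
      have hm2 := (req_pair_le' hG hd hS hS6 hBm hcB hBS hcard).2.2.1
      have hden : (1 : ℚ) ≤ ((G \ clF M B).card : ℚ) - 1 := by
        have : (2 : ℚ) ≤ ((G \ clF M B).card : ℚ) := by exact_mod_cast hm2
        linarith
      have hnum : loss M 4 G B z + loss M 4 G B z' ≤ 66 / 575 := by
        have : req M 4 B * (11 / 46) ≤ 6 / 25 * (11 / 46) := by nlinarith
        linarith
      calc (loss M 4 G B z + loss M 4 G B z') / (((G \ clF M B).card : ℚ) - 1)
          ≤ (66 / 575) / 1 := div_le_div₀ (by norm_num) hnum (by norm_num) hden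
        _ = 66 / 575 := by norm_num
    have hload := load2_le_card_ex2_mul (M := M) (q := 4) (G := G) (S := S) hw
    have h6 : ((ex2 M 4 G S).card : ℚ) ≤ 6 := by exact_mod_cast hex6
    calc load2 M 4 G S ≤ _ := hload
      _ ≤ 6 * (66 / 575) := by nlinarith
      _ ≤ 7 / 10 - ρ := by rw [hρ]; norm_num
      _ ≤ cap2 M 4 G S := hcap2
  · -- at most one fat pair member
    have htwo' : ∀ B₁ B₂, Fat B₁ → Fat B₂ → B₁ = B₂ := fun B₁ B₂ h₁ h₂ => by
      by_contra hne
      exact htwo ⟨B₁, B₂, h₁, h₂, hne⟩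
    have hone : ∀ v ∈ nonColoops M S,
        (((nonColoops M S).erase v).filter (fun t => (S.erase v).erase t ∈ membersIn M (Uq M (4 + 2) 4) G ∧
          G \ S ⊆ clF M ((S.erase v).erase t))).card ≤ 1 := by
      intro v hv
      rw [Finset.card_le_one]
      intro a ha b hb
      rw [Finset.mem_filter] at ha hb
      by_contra hab
      have hpa := pair_shape_of_erase_erase' hv (Finset.mem_erase.1 ha.1).2 (Ne.symm (Finset.mem_erase.1 ha.1).1)
      have hpb := pair_shape_of_erase_erase' hv (Finset.mem_erase.1 hb.1).2 (Ne.symm (Finset.mem_erase.1 hb.1).1)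
      have haS : a ∈ S.erase v := Finset.mem_erase.2 ⟨(Finset.mem_erase.1 ha.1).1, (mem_nonColoops.1 (Finset.mem_erase.1 ha.1).2).1⟩
      have hbS : b ∈ S.erase v := Finset.mem_erase.2 ⟨(Finset.mem_erase.1 hb.1).1, (mem_nonColoops.1 (Finset.mem_erase.1 hb.1).2).1⟩
      have := htwo' _ _ ⟨ha.2.1, hpa.1, hpa.2.1, hpa.2.2, ha.2.2⟩ ⟨hb.2.1, hpb.1, hpb.2.1, hpb.2.2, hb.2.2⟩
      exact hab (Finset.erase_injOn (S.erase v) haS hbS this)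
    have hw : ∀ B ∈ ex2 M 4 G S, w2 M 4 G B S ≤ 9 / 220 + (if G \ S ⊆ clF M B then (27 / 275 - 9 / 220 : ℚ) else 0) := by
      intro B hB
      obtain ⟨hBm, hcB, hBS, hcard, hsub, hB0⟩ := hpair B hB
      obtain ⟨z, z', hzz', hPz⟩ := Finset.card_eq_two.1 hcard
      have hPz' : S \ B = {z', z} := by rw [hPz, Finset.pair_comm]
      rw [hw2 B hB z z' hPz hzz']
      obtain ⟨hSv, hv⟩ := hcov B hB z z' hPz hzz'
      obtain ⟨hSv', hv'⟩ := hcov B hB z' z hPz' hzz'.symm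
      have hL := L1_erase_le_two_one hG hd hS hS6 ha hxK hcol hv hSv (hone z' hv)
      have hL' := L1_erase_le_two_one hG hd hS hS6 ha hxK hcol hv' hSv' (hone z hv')
      have hl1 := hloss B hB z z' hPz hzz' (22 / 25) (by push_cast at hL; linarith)
      have hl2 := hloss B hB z' z hPz' hzz'.symm (22 / 25) (by push_cast at hL'; linarith)
      rw [hfrac22] at hl1 hl2
      have hm2 := (req_pair_le' hG hd hS hS6 hBm hcB hBS hcard).2.2.1
      by_cases hf : G \ S ⊆ clF M B
      · rw [if_pos hf]
        have hreq := (req_pair_le' hG hd hS hS6 hBm hcB hBS hcard).1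
        have hden : (1 : ℚ) ≤ ((G \ clF M B).card : ℚ) - 1 := by
          have : (2 : ℚ) ≤ ((G \ clF M B).card : ℚ) := by exact_mod_cast hm2
          linarith
        have hnum : loss M 4 G B z + loss M 4 G B z' ≤ 27 / 275 := by
          have : req M 4 B * (9 / 44) ≤ 6 / 25 * (9 / 44) := by nlinarith
          linarith
        calc (loss M 4 G B z + loss M 4 G B z') / (((G \ clF M B).card : ℚ) - 1)
            ≤ (27 / 275) / 1 := div_le_div₀ (by norm_num) hnum (by norm_num) hden
          _ = 9 / 220 + (27 / 275 - 9 / 220) := by norm_num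
      · rw [if_neg hf, add_zero]
        have hreq := (req_pair_le' hG hd hS hS6 hBm hcB hBS hcard).2.1 hf
        have hm3 := (req_pair_le' hG hd hS hS6 hBm hcB hBS hcard).2.2.2 hf
        have hden : (2 : ℚ) ≤ ((G \ clF M B).card : ℚ) - 1 := by
          have : (3 : ℚ) ≤ ((G \ clF M B).card : ℚ) := by exact_mod_cast hm3
          linarith
        have hnum : loss M 4 G B z + loss M 4 G B z' ≤ 9 / 110 := by
          have : req M 4 B * (9 / 44) ≤ 1 / 5 * (9 / 44) := by nlinarith
          linarith
        calc (loss M 4 G B z + loss M 4 G B z') / (((G \ clF M B).card : ℚ) - 1)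
            ≤ (9 / 110) / 2 := div_le_div₀ (by norm_num) hnum (by norm_num) hden
          _ = 9 / 220 := by norm_num
    have hload : load2 M 4 G S ≤ ∑ B ∈ ex2 M 4 G S, (9 / 220 + (if G \ S ⊆ clF M B then (27 / 275 - 9 / 220 : ℚ) else 0)) := by
      unfold load2
      rw [← Finset.sum_filter_ne_zero]
      exact Finset.sum_le_sum (fun B hB => hw B hB)
    rw [Finset.sum_add_distrib, Finset.sum_const, Finset.sum_ite, Finset.sum_const_zero, add_zero,
      Finset.sum_const, nsmul_eq_mul, nsmul_eq_mul] at hload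
    have h1 : ((ex2 M 4 G S).filter (fun B => G \ S ⊆ clF M B)).card ≤ 1 := by
      rw [Finset.card_le_one]
      intro a ha b hb
      rw [Finset.mem_filter] at ha hb
      by_contra hab
      obtain ⟨ham, hac, haS, hak, -, -⟩ := hpair a ha.1
      obtain ⟨hbm, hbc, hbS, hbk, -, -⟩ := hpair b hb.1
      exact hab (htwo' a b ⟨ham, hac, haS, hak, ha.2⟩ ⟨hbm, hbc, hbS, hbk, hb.2⟩)
    have h1' : (((ex2 M 4 G S).filter (fun B => G \ S ⊆ clF M B)).card : ℚ) ≤ 1 := by exact_mod_cast h1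
    have h6 : ((ex2 M 4 G S).card : ℚ) ≤ 6 := by exact_mod_cast hex6
    have h0 : (0 : ℚ) ≤ (((ex2 M 4 G S).filter (fun B => G \ S ⊆ clF M B)).card : ℚ) := Nat.cast_nonneg _
    calc load2 M 4 G S ≤ _ := hload
      _ ≤ 7 / 10 - ρ := by nlinarith
      _ ≤ cap2 M 4 G S := hcap2

end TwoOneC

end PercRepro.Shadow
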